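import Summits.RiemannHypothesis.RiemannHypothesis.Theorems.HandoffDodgerTransform
import HarnessLib

/-!
# HANDOFF — a cut-off cosine polynomial on the COLLAR next to its edge (rh-explicit, track «HANDOFF», seat prove-2 gen9, ATTEMPT-16 Lemma D1 entry point / ATTEMPT-18 (R-3))

HONEST FRAMING. Nothing here bears on the truth of RH; this is trigonometry. For the cut-off cosine polynomial
`F = cutoffCosPoly b K a`, `F(x) = (1/2b)(1 + 2Σ_{k<K} a_{k+1}cos(ℓ_{k+1}x))` on `[−b, b]` (`ℓ_k = πk/b`), and `0 ≤ σ ≤ 2b`: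

  `F(b − σ) = (1/2b)(1 + 2Σ_k a_{k+1}(−1)^{k+1}cos(ℓ_{k+1}σ))`                       (`cutoffCosPoly_apply_edge_sub`),
  `Re F(b − σ) = Re F(b) − (2/b)Σ_k a_{k+1}(−1)^{k+1}sin²(ℓ_{k+1}σ/2)`                (`re_cutoffCosPoly_edge_sub`).

For the dodger (`a = dodgerCoeff`, `−2(−1)^k... ` i.e. `2a_{k+1}(−1)^{k+1} = −w_k`, `w_k = P_T(ν_k)/Π_{m≠k}(1 − ν_k/ν_m)`, HOME `HandoffDodgerEdgeValue.lean`) this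
reads `F₀(b − σ) = c_∞/(2b) + (1/b)Σ_k w_k sin²(ℓ_{k+1}σ/2)` — the collar profile whose control (ATTEMPT-16 Lemma D1: comparison with
`(c_∞/2b)·Φ(p₁σ²)`, `Φ = HandoffDodgerProfileDefs.dodgerPhi`) is the remaining analytic brick of the GAIN side; the collar lemmas
(`HandoffDodgerCollar`) then take any monotone minorant. No `sorry`, standard axioms, no definitions.

References: this track (ATTEMPT-16 §3 Lemma D1; ATTEMPT-18 §3 (R-3)).
-/

set_option linter.dupNamespace false

noncomputable section

open Complex Finset
open scoped Real

namespace Summit.RiemannHypothesis.RiemannHypothesis.Theorems.Handoff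

/-- Inside the window the cut-off cosine polynomial is the cosine polynomial. [folklore] -/
theorem cutoffCosPoly_apply_of_mem {b : ℝ} (K : ℕ) (a : ℕ → ℝ) {x : ℝ} (hx : x ∈ Set.Icc (-b) b) :
    cutoffCosPoly b K a x =
      (((1 / (2 * b)) * (1 + 2 * ∑ k ∈ Finset.range K, a (k + 1) * Real.cos (latticeFreq b (k + 1) * x)) : ℝ) : ℂ) := by
  rw [cutoffCosPoly, Set.indicator_of_mem hx]

/-- At the edge: `cos(ℓ_{k+1}b) = (−1)^{k+1}`. [folklore] -/
theorem cos_latticeFreq_mul_edge {b : ℝ} (hb : b ≠ 0) (k : ℕ) : Real.cos (latticeFreq b (k + 1) * b) = (-1) ^ (k + 1) := by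
  rw [show latticeFreq b (k + 1) * b = ((k + 1 : ℕ) : ℝ) * π by
    unfold latticeFreq; rw [div_mul_cancel₀ _ hb, mul_comm]]
  exact Real.cos_nat_mul_pi _

/-- Reflection at the edge: `cos(ℓ_{k+1}(b − σ)) = (−1)^{k+1}cos(ℓ_{k+1}σ)`. [folklore] -/
theorem cos_latticeFreq_mul_edge_sub {b : ℝ} (hb : b ≠ 0) (k : ℕ) (σ : ℝ) :
    Real.cos (latticeFreq b (k + 1) * (b - σ)) = (-1) ^ (k + 1) * Real.cos (latticeFreq b (k + 1) * σ) := by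
  rw [mul_sub, show latticeFreq b (k + 1) * b = ((k + 1 : ℕ) : ℝ) * π by
    unfold latticeFreq; rw [div_mul_cancel₀ _ hb, mul_comm]]
  exact Real.cos_nat_mul_pi_sub _ _

/-- **The cut-off cosine polynomial on the collar**: for `0 ≤ σ ≤ 2b`,
`F(b − σ) = (1/2b)(1 + 2Σ_{k<K} a_{k+1}(−1)^{k+1}cos(ℓ_{k+1}σ))`. [this track, ATTEMPT-16 §3] -/
theorem cutoffCosPoly_apply_edge_sub {b : ℝ} (hb : 0 < b) (K : ℕ) (a : ℕ → ℝ) {σ : ℝ} (h0 : 0 ≤ σ) (h2 : σ ≤ 2 * b) :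
    cutoffCosPoly b K a (b - σ) =
      (((1 / (2 * b)) * (1 + 2 * ∑ k ∈ Finset.range K,
          a (k + 1) * ((-1) ^ (k + 1) * Real.cos (latticeFreq b (k + 1) * σ))) : ℝ) : ℂ) := by
  rw [cutoffCosPoly_apply_of_mem K a (Set.mem_Icc.2 ⟨by linarith, by linarith⟩)]
  simp_rw [cos_latticeFreq_mul_edge_sub hb.ne']

/-- **The collar profile in gain form**: for `0 ≤ σ ≤ 2b`,
`Re F(b − σ) = Re F(b) − (2/b)·Σ_{k<K} a_{k+1}(−1)^{k+1}sin²(ℓ_{k+1}σ/2)`. [this track, ATTEMPT-16 §3 Lemma D1 entry point] -/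
theorem re_cutoffCosPoly_edge_sub {b : ℝ} (hb : 0 < b) (K : ℕ) (a : ℕ → ℝ) {σ : ℝ} (h0 : 0 ≤ σ) (h2 : σ ≤ 2 * b) :
    (cutoffCosPoly b K a (b - σ)).re =
      (cutoffCosPoly b K a b).re -
        2 / b * ∑ k ∈ Finset.range K, a (k + 1) * (-1) ^ (k + 1) * Real.sin (latticeFreq b (k + 1) * σ / 2) ^ 2 := by
  rw [cutoffCosPoly_apply_edge_sub hb K a h0 h2, Complex.ofReal_re,
    cutoffCosPoly_apply_of_mem K a (Set.mem_Icc.2 ⟨by linarith, le_rfl⟩), Complex.ofReal_re]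
  have hcos : ∀ k : ℕ, Real.cos (latticeFreq b (k + 1) * σ) = 1 - 2 * Real.sin (latticeFreq b (k + 1) * σ / 2) ^ 2 := by
    intro k
    rw [Real.sin_sq_eq_half_sub, show 2 * (latticeFreq b (k + 1) * σ / 2) = latticeFreq b (k + 1) * σ by ring]
    ring
  simp_rw [hcos, cos_latticeFreq_mul_edge hb.ne']
  have key : ∑ k ∈ Finset.range K, a (k + 1) * ((-1) ^ (k + 1) * (1 - 2 * Real.sin (latticeFreq b (k + 1) * σ / 2) ^ 2)) =
      ∑ k ∈ Finset.range K, a (k + 1) * (-1) ^ (k + 1) -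
        2 * ∑ k ∈ Finset.range K, a (k + 1) * (-1) ^ (k + 1) * Real.sin (latticeFreq b (k + 1) * σ / 2) ^ 2 := by
    rw [Finset.mul_sum, ← Finset.sum_sub_distrib]
    exact Finset.sum_congr rfl fun k _ => by ring
  rw [key]
  ring

/-- In particular `F(b − σ) ≥ F(b)` termwise-weighted: if every `a_{k+1}(−1)^{k+1} ≤ 0` then `Re F(b − σ) ≥ Re F(b)` on the collar. [folklore] -/
theorem re_cutoffCosPoly_edge_le_of_nonpos {b : ℝ} (hb : 0 < b) (K : ℕ) (a : ℕ → ℝ)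
    (ha : ∀ k ∈ Finset.range K, a (k + 1) * (-1) ^ (k + 1) ≤ 0) {σ : ℝ} (h0 : 0 ≤ σ) (h2 : σ ≤ 2 * b) :
    (cutoffCosPoly b K a b).re ≤ (cutoffCosPoly b K a (b - σ)).re := by
  rw [re_cutoffCosPoly_edge_sub hb K a h0 h2, le_sub_iff_add_le, add_le_iff_nonpos_right]
  have hs : ∑ k ∈ Finset.range K, a (k + 1) * (-1) ^ (k + 1) * Real.sin (latticeFreq b (k + 1) * σ / 2) ^ 2 ≤ 0 :=
    Finset.sum_nonpos fun k hk => mul_nonpos_of_nonpos_of_nonneg (ha k hk) (sq_nonneg _)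
  have : 0 ≤ 2 / b := by positivity
  nlinarith

end Summit.RiemannHypothesis.RiemannHypothesis.Theorems.Handoff

end
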